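import Summits.QuantumFields.YangMills.Theorems.ColdStartUniversalityColdStartSolutionsExistCoordMartingale
import Summits.QuantumFields.YangMills.Theorems.ColdStartUniversalityColdStartSolutionsExistSupSums
import Summits.QuantumFields.YangMills.Theorems.ColdStartUniversalityColdStartSolutionsExistProgressive
import Literature.Analysis.FunctionSpaces.ItoProcessesProofs
import HarnessLib

/-!
# Route `ColdStartUniversality`, support item S (stmt-QuantumFields-24811), line `piwiener`:
# vector Picard iteration I — coefficients, integrands, one Picard step exists

Helper file (lead `ym-line-csu-p1`) for stub A `stub_ambientStrongExistence` (Itô's existence theorem for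
Lipschitz SYSTEMS, Revuz–Yor IX (2.1) / Itô 1951, on a probability space carrying a Brownian VECTOR `W`,
joint raw filtration `𝓕 = hW.natFiltration`).  This is the port of the scheme-level infrastructure of the
tree's 1-D proof (`Literature/Analysis/FunctionSpaces/ItoProcessesProofs.lean`, sections `PicardStep`,
`PicardScheme`) to the system `dX_i = b_i(X) dt + Σₙ σ_{i n}(X) dW^{c i n}`, `i ∈ ι`, `n ∈ κ` (finite), with
time-independent coefficients that are globally Lipschitz in the sum-of-squares sense
(`Σ_i (b x i - b y i)² ≤ K Σ_i (x_i - y_i)²`, `Σ_i Σ_n (σ x i n - σ y i n)² ≤ K Σ_i (x_i - y_i)²`).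

No definition is introduced (gate rule): the Picard INVARIANT of a vector process `U : ι → ℝ≥0 → Ω → ℝ`
is spelled out as the three hypotheses "coordinates progressive", "a.s. continuous paths", "`L²(sup)` on
bounded intervals", and ONE PICARD STEP `V = x₀ + ∫ b(U) ds + Σₙ ∫ σₙ(U) dW` is spelled out with its Itô
integrals `JV i n` (square-integrable martingales, progressive versions).  Contents:

* `vecPicard_sub_sq_le`, `vecPicard_continuous_coord` — a sum-of-squares Lipschitz map has Lipschitz
  (hence continuous) coordinates; `vecPicard_linearGrowth` — linear growth;
* `vecPicard_isStronglyProgressive_comp` — `(s, ω) ↦ f (U_s ω)` is progressive for continuous `f` and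
  coordinatewise progressive `U`; `vecPicard_measurable` — marginals are measurable;
* `vecPicard_sqErr_ne_top` — `E ∫₀ᵗ σ(U_s)_{i n}² ds < ∞` along an `L²(sup)` process;
* `vecPicard_aemeasurable_biSup` — a.e.-measurability of `sup_{s ≤ t} Σ_i (U - V)²`;
* `vecPicard_integrableOn_drift`, `vecPicard_continuous_timeIntegral` — pathwise integrability of the drift
  along a continuous path, continuity of its time integral;
* `vecPicard_step_exists` — **one Picard step exists** from every invariant process.

RECORD-rung plumbing; nothing here bears on the Yang–Mills mass gap.
-/

set_option autoImplicit false

noncomputable section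

namespace Summit.QuantumFields.YangMills.Theorems.ColdStartUniversality

open MeasureTheory ProbabilityTheory Filter Topology Finset
open scoped NNReal ENNReal BigOperators
open Literature.Probability.Process Literature.Analysis.FunctionSpaces

section Coefficients

variable {ι : Type*} [Fintype ι]

/-- A single square is dominated by the sum of squares. [folklore] -/
theorem vecPicard_sq_le_sum_sq (v : ι → ℝ) (i : ι) : v i ^ 2 ≤ ∑ j, v j ^ 2 :=
  Finset.single_le_sum (f := fun j => v j ^ 2) (fun _ _ => sq_nonneg _) (Finset.mem_univ i)

/-- **Coordinates of a sum-of-squares Lipschitz map are Lipschitz**: from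
`Σ_i (f x i - f y i)² ≤ K Σ_i (x_i - y_i)²` we get `(f x i - f y i)² ≤ K · card ι · ‖x - y‖²`. [folklore] -/
theorem vecPicard_sub_sq_le {α : Type*} {f : (ι → ℝ) → α → ℝ} {K : ℝ} (hK : 0 ≤ K)
    (hf : ∀ x y : ι → ℝ, ∀ a, (f x a - f y a) ^ 2 ≤ K * ∑ i, (x i - y i) ^ 2) (x y : ι → ℝ) (a : α) :
    (f x a - f y a) ^ 2 ≤ K * (Fintype.card ι) * ‖x - y‖ ^ 2 := by
  have hsum : ∑ i, (x i - y i) ^ 2 ≤ (Fintype.card ι : ℝ) * ‖x - y‖ ^ 2 := by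
    calc ∑ i, (x i - y i) ^ 2 ≤ ∑ _i : ι, ‖x - y‖ ^ 2 := by
          refine Finset.sum_le_sum fun i _ => ?_
          have h := norm_le_pi_norm (x - y) i
          rw [Pi.sub_apply, Real.norm_eq_abs] at h
          rw [← sq_abs]
          exact pow_le_pow_left₀ (abs_nonneg _) h 2
      _ = (Fintype.card ι : ℝ) * ‖x - y‖ ^ 2 := by
          rw [Finset.sum_const, nsmul_eq_mul, Finset.card_univ]
  calc (f x a - f y a) ^ 2 ≤ K * ∑ i, (x i - y i) ^ 2 := hf x y a
    _ ≤ K * ((Fintype.card ι : ℝ) * ‖x - y‖ ^ 2) := mul_le_mul_of_nonneg_left hsum hK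
    _ = K * (Fintype.card ι) * ‖x - y‖ ^ 2 := by ring

/-- **Coordinates of a sum-of-squares Lipschitz map are continuous.** [folklore] -/
theorem vecPicard_continuous_coord {α : Type*} {f : (ι → ℝ) → α → ℝ} {K : ℝ} (hK : 0 ≤ K)
    (hf : ∀ x y : ι → ℝ, ∀ a, (f x a - f y a) ^ 2 ≤ K * ∑ i, (x i - y i) ^ 2) (a : α) :
    Continuous fun x => f x a := by
  set C : ℝ := K * (Fintype.card ι) with hC
  have hC0 : 0 ≤ C := by positivity
  have hlip : ∀ x y : ι → ℝ, |f x a - f y a| ≤ Real.sqrt C * ‖x - y‖ := by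
    intro x y
    have h2 : |f x a - f y a| ^ 2 ≤ (Real.sqrt C * ‖x - y‖) ^ 2 := by
      rw [sq_abs, mul_pow, Real.sq_sqrt hC0, hC]; exact vecPicard_sub_sq_le hK hf x y a
    exact (pow_le_pow_iff_left₀ (abs_nonneg (f x a - f y a)) (by positivity) two_ne_zero).1 h2
  refine Metric.continuous_iff.2 fun x ε hε => ⟨ε / (Real.sqrt C + 1), by positivity, fun y hy => ?_⟩
  rw [Real.dist_eq, dist_eq_norm] at *
  calc |f y a - f x a| ≤ Real.sqrt C * ‖y - x‖ := hlip y x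
    _ ≤ Real.sqrt C * (ε / (Real.sqrt C + 1)) := by gcongr
    _ < ε := by
        rw [mul_div_assoc', div_lt_iff₀ (by positivity)]
        nlinarith [Real.sqrt_nonneg C]

/-- From the total sum-of-squares Lipschitz bound to the coordinatewise one (drift shape). [folklore] -/
theorem vecPicard_coord_sq_le_of_sum {f : (ι → ℝ) → ι → ℝ} {K : ℝ}
    (hf : ∀ x y : ι → ℝ, ∑ i, (f x i - f y i) ^ 2 ≤ K * ∑ i, (x i - y i) ^ 2) :
    ∀ x y : ι → ℝ, ∀ i, (f x i - f y i) ^ 2 ≤ K * ∑ j, (x j - y j) ^ 2 := fun x y i =>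
  (vecPicard_sq_le_sum_sq (fun j => f x j - f y j) i).trans (hf x y)

/-- From the total sum-of-squares Lipschitz bound to the coordinatewise one (noise shape, index pair
`(i, n)`). [folklore] -/
theorem vecPicard_coord_sq_le_of_sum₂ {κ : Type*} [Fintype κ] {g : (ι → ℝ) → ι → κ → ℝ} {K : ℝ}
    (hg : ∀ x y : ι → ℝ, ∑ i, ∑ n, (g x i n - g y i n) ^ 2 ≤ K * ∑ i, (x i - y i) ^ 2) :
    ∀ x y : ι → ℝ, ∀ p : ι × κ, (g x p.1 p.2 - g y p.1 p.2) ^ 2 ≤ K * ∑ j, (x j - y j) ^ 2 := by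
  intro x y p
  refine le_trans ?_ (hg x y)
  calc (g x p.1 p.2 - g y p.1 p.2) ^ 2 ≤ ∑ n, (g x p.1 n - g y p.1 n) ^ 2 :=
        Finset.single_le_sum (f := fun n => (g x p.1 n - g y p.1 n) ^ 2) (fun _ _ => sq_nonneg _)
          (Finset.mem_univ p.2)
    _ ≤ ∑ i, ∑ n, (g x i n - g y i n) ^ 2 :=
        Finset.single_le_sum (f := fun i => ∑ n, (g x i n - g y i n) ^ 2)
          (fun _ _ => Finset.sum_nonneg fun _ _ => sq_nonneg _) (Finset.mem_univ p.1)

/-- **Linear growth** from the Lipschitz bound at `y = 0`: `(f x a)² ≤ 2 (f 0 a)² + 2 K Σ_i x_i²`.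
[folklore] -/
theorem vecPicard_linearGrowth {α : Type*} {f : (ι → ℝ) → α → ℝ} {K : ℝ}
    (hf : ∀ x y : ι → ℝ, ∀ a, (f x a - f y a) ^ 2 ≤ K * ∑ i, (x i - y i) ^ 2) (x : ι → ℝ) (a : α) :
    (f x a) ^ 2 ≤ 2 * (f 0 a) ^ 2 + 2 * K * ∑ i, x i ^ 2 := by
  have h := hf x 0 a
  simp only [Pi.zero_apply, sub_zero] at h
  nlinarith [sq_nonneg (f x a - f 0 a - f 0 a)]

end Coefficients

section Processes

variable {Ω : Type*} {mΩ : MeasurableSpace Ω} {P : Measure Ω} {𝓕 : Filtration ℝ≥0 mΩ}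
  {ι : Type*} [Fintype ι]

/-- **Composition with a continuous function of the state is progressive**: if every coordinate
`U i` is progressive then so is `(s, ω) ↦ f (U_s ω)` for continuous `f : (ι → ℝ) → ℝ`. [folklore] -/
theorem vecPicard_isStronglyProgressive_comp {U : ι → ℝ≥0 → Ω → ℝ}
    (hU : ∀ i, IsStronglyProgressive 𝓕 (U i)) {f : (ι → ℝ) → ℝ} (hf : Continuous f) :
    IsStronglyProgressive 𝓕 (fun s ω => f (fun j => U j s ω)) := by
  have hpi := isStronglyProgressive_pi hU
  intro t
  letI : MeasurableSpace (Set.Iic t × Ω) := Subtype.instMeasurableSpace.prod (𝓕 t)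
  exact (hf.measurable.comp (hpi t).measurable).stronglyMeasurable

/-- Marginals of a progressive real process are measurable. [folklore] -/
theorem vecPicard_measurable {U : ℝ≥0 → Ω → ℝ} (hU : IsStronglyProgressive 𝓕 U) (s : ℝ≥0) :
    Measurable (U s) :=
  (IsStronglyProgressive.measurable_uncurry hU).comp (measurable_const.prodMk measurable_id)

/-- The sum of squared differences of two coordinatewise progressive vector processes is progressive.
[folklore] -/
theorem vecPicard_isStronglyProgressive_sumSq {U V : ι → ℝ≥0 → Ω → ℝ}
    (hU : ∀ i, IsStronglyProgressive 𝓕 (U i)) (hV : ∀ i, IsStronglyProgressive 𝓕 (V i)) :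
    IsStronglyProgressive 𝓕 (fun s ω => ∑ i, (U i s ω - V i s ω) ^ 2) := by
  intro t
  letI : MeasurableSpace (Set.Iic t × Ω) := Subtype.instMeasurableSpace.prod (𝓕 t)
  have hm : ∀ i, Measurable (fun p : Set.Iic t × Ω => (U i p.1 p.2 - V i p.1 p.2) ^ 2) := fun i =>
    ((hU i t).measurable.sub (hV i t).measurable).pow_const 2
  exact (Finset.measurable_sum (Finset.univ : Finset ι) fun i _ => hm i).stronglyMeasurable

/-- **A.e.-measurability of the running supremum of the squared distance** `sup_{s≤t} Σ_i (U_s - V_s)_i²`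
for coordinatewise progressive, a.s.-continuous processes. [folklore] -/
theorem vecPicard_aemeasurable_biSup {U V : ι → ℝ≥0 → Ω → ℝ}
    (hU : ∀ i, IsStronglyProgressive 𝓕 (U i)) (hV : ∀ i, IsStronglyProgressive 𝓕 (V i))
    (hUc : ∀ᵐ ω ∂P, ∀ i, Continuous fun t => U i t ω) (hVc : ∀ᵐ ω ∂P, ∀ i, Continuous fun t => V i t ω)
    (t : ℝ≥0) :
    AEMeasurable (fun ω => ⨆ s ∈ Set.Iic t, ENNReal.ofReal (∑ i, (U i s ω - V i s ω) ^ 2)) P := by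
  refine aemeasurable_biSup_Iic (Z := fun s ω => ∑ i, (U i s ω - V i s ω) ^ 2) (φ := ENNReal.ofReal)
    ENNReal.continuous_ofReal (fun s => vecPicard_measurable (vecPicard_isStronglyProgressive_sumSq hU hV) s)
    ?_ t
  filter_upwards [hUc, hVc] with ω h1 h2
  exact continuous_finsetSum _ fun i _ => ((h1 i).sub (h2 i)).pow 2

/-- **`E ∫₀ᵗ g(U_s)² ds < ∞` along an `L²(sup)` vector process** for a state functional with
`g(x)² ≤ C₀ + C₁ Σ_i x_i²`. (Port of `PicardInv.lintegral_along_sq_lt_top`.) [folklore] -/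
theorem vecPicard_sqErr_ne_top [IsProbabilityMeasure P] {U : ι → ℝ≥0 → Ω → ℝ}
    (hU2 : ∀ t : ℝ≥0, ∫⁻ ω, ⨆ s ∈ Set.Iic t, ENNReal.ofReal (∑ i, U i s ω ^ 2) ∂P < ∞)
    {g : (ι → ℝ) → ℝ} {C₀ C₁ : ℝ} (hC₀ : 0 ≤ C₀) (hC₁ : 0 ≤ C₁)
    (hg : ∀ x, g x ^ 2 ≤ C₀ + C₁ * ∑ i, x i ^ 2) (t : ℝ≥0) :
    sqErr (fun s ω => g (fun j => U j s ω)) 0 P t ≠ ⊤ := by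
  rw [sqErr]
  simp only [Pi.zero_apply, sub_zero]
  have hpt : ∀ ω, ∫⁻ s in Set.Icc (0 : ℝ) t, ENNReal.ofReal (g (fun j => U j s.toNNReal ω) ^ 2) ≤
      (ENNReal.ofReal C₀ + ENNReal.ofReal C₁ *
        ⨆ s ∈ Set.Iic t, ENNReal.ofReal (∑ i, U i s ω ^ 2)) * volume (Set.Icc (0 : ℝ) t) := by
    intro ω
    rw [← setLIntegral_const]
    refine setLIntegral_mono' measurableSet_Icc fun s hs => ?_
    have hst : s.toNNReal ∈ Set.Iic t := Real.toNNReal_le_iff_le_coe.2 hs.2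
    calc ENNReal.ofReal (g (fun j => U j s.toNNReal ω) ^ 2)
        ≤ ENNReal.ofReal (C₀ + C₁ * ∑ i, U i s.toNNReal ω ^ 2) := ENNReal.ofReal_le_ofReal (hg _)
      _ = ENNReal.ofReal C₀ + ENNReal.ofReal C₁ * ENNReal.ofReal (∑ i, U i s.toNNReal ω ^ 2) := by
          rw [ENNReal.ofReal_add hC₀ (mul_nonneg hC₁ (Finset.sum_nonneg fun _ _ => sq_nonneg _)),
            ENNReal.ofReal_mul hC₁]
      _ ≤ _ := by
          gcongr
          exact le_iSup₂_of_le s.toNNReal hst le_rfl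
  refine ne_of_lt ?_
  calc ∫⁻ ω, (∫⁻ s in Set.Icc (0 : ℝ) t, ENNReal.ofReal (g (fun j => U j s.toNNReal ω) ^ 2)) ∂P
      ≤ ∫⁻ ω, (ENNReal.ofReal C₀ + ENNReal.ofReal C₁ *
          ⨆ s ∈ Set.Iic t, ENNReal.ofReal (∑ i, U i s ω ^ 2)) * volume (Set.Icc (0 : ℝ) t) ∂P :=
        lintegral_mono hpt
    _ = (ENNReal.ofReal C₀ * P Set.univ + ENNReal.ofReal C₁ *
          ∫⁻ ω, ⨆ s ∈ Set.Iic t, ENNReal.ofReal (∑ i, U i s ω ^ 2) ∂P) * volume (Set.Icc (0 : ℝ) t) := by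
        rw [lintegral_mul_const' _ _ measure_Icc_lt_top.ne, lintegral_add_left measurable_const,
          lintegral_const, lintegral_const_mul' _ _ ENNReal.ofReal_ne_top]
    _ < ⊤ := by
        refine ENNReal.mul_lt_top (ENNReal.add_lt_top.2 ⟨?_, ?_⟩) measure_Icc_lt_top
        · exact ENNReal.mul_lt_top ENNReal.ofReal_lt_top (measure_lt_top _ _)
        · exact ENNReal.mul_lt_top ENNReal.ofReal_lt_top (hU2 t)

omit [Fintype ι] in
/-- **Pathwise local integrability of a continuous state functional along a continuous path.**
[folklore] -/
theorem vecPicard_integrableOn_comp {U : ι → ℝ≥0 → Ω → ℝ}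
    {g : (ι → ℝ) → ℝ} (hg : Continuous g) {ω : Ω} (hc : ∀ i, Continuous fun t => U i t ω) (t : ℝ≥0) :
    IntegrableOn (fun s : ℝ => g (fun j => U j s.toNNReal ω)) (Set.Icc 0 t) := by
  have hpath : Continuous fun s : ℝ => g (fun j => U j s.toNNReal ω) :=
    hg.comp (continuous_pi fun j => (hc j).comp continuous_real_toNNReal)
  exact hpath.continuousOn.integrableOn_compact isCompact_Icc

omit [Fintype ι] in
/-- The time integral of a continuous state functional along an a.s. continuous vector process has
continuous paths almost surely... pathwise form: continuity for a path all of whose coordinates are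
continuous. [folklore] -/
theorem vecPicard_continuous_timeIntegral {U : ι → ℝ≥0 → Ω → ℝ}
    {g : (ι → ℝ) → ℝ} (hg : Continuous g) {ω : Ω} (hc : ∀ i, Continuous fun t => U i t ω) :
    Continuous (timeIntegral (fun s ω => g (fun j => U j s ω)) · ω) :=
  continuous_timeIntegral fun t => vecPicard_integrableOn_comp hg hc t

end Processes

section Step

variable {Ω : Type*} {mΩ : MeasurableSpace Ω} {P : Measure Ω} {d : ℕ}
  {W : ℝ≥0 → Ω → (Fin d → ℝ)} {ι κ : Type*} [Fintype ι] [Fintype κ]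
  {b : (ι → ℝ) → ι → ℝ} {σ : (ι → ℝ) → ι → κ → ℝ} {K : ℝ}

/-- **The Itô integrals of one Picard step exist** (square-integrable martingales, progressive versions
vanishing at `0`): along a coordinatewise progressive, a.s. continuous, `L²(sup)` process `U`, each
integrand `σ(U_s)_{i n}` is progressive with `E ∫₀ᵗ σ(U_s)²_{i n} ds < ∞`.  Revuz–Yor IX (2.1), proof
(the martingale part of the map `S`). [folklore] -/
theorem vecPicard_ito_exists [IsProbabilityMeasure P] (hW : IsBrownianVec W P) (c : ι → κ → Fin d)
    (hK : 0 ≤ K) (hσ : ∀ x y : ι → ℝ, ∑ i, ∑ n, (σ x i n - σ y i n) ^ 2 ≤ K * ∑ i, (x i - y i) ^ 2)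
    {U : ι → ℝ≥0 → Ω → ℝ} (hU : ∀ i, IsStronglyProgressive hW.natFiltration (U i))
    (hU2 : ∀ t : ℝ≥0, ∫⁻ ω, ⨆ s ∈ Set.Iic t, ENNReal.ofReal (∑ i, U i s ω ^ 2) ∂P < ∞)
    (i : ι) (n : κ) :
    ∃ J : ℝ≥0 → Ω → ℝ,
      IsItoIntegral (fun s ω => σ (fun j => U j s ω) i n) (fun s ω => W s ω (c i n)) J hW.natFiltration P ∧
      Martingale J hW.natFiltration P ∧ (∀ t, MemLp (J t) 2 P) ∧
      IsStronglyProgressive hW.natFiltration J ∧ ∀ ω, J 0 ω = 0 := by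
  have hσ' := vecPicard_coord_sq_le_of_sum₂ hσ
  have hcont : Continuous fun x => σ x i n :=
    vecPicard_continuous_coord (f := fun x (p : ι × κ) => σ x p.1 p.2) hK hσ' (i, n)
  have hprog : IsStronglyProgressive hW.natFiltration (fun s ω => σ (fun j => U j s ω) i n) :=
    vecPicard_isStronglyProgressive_comp hU hcont
  have hgrow : ∀ x : ι → ℝ, (σ x i n) ^ 2 ≤ 2 * (σ 0 i n) ^ 2 + 2 * K * ∑ j, x j ^ 2 := fun x =>
    vecPicard_linearGrowth (f := fun x (p : ι × κ) => σ x p.1 p.2) hσ' x (i, n)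
  have hfin : ∀ t : ℝ≥0, sqErr (fun s ω => σ (fun j => U j s ω) i n) 0 P t ≠ ⊤ := fun t =>
    vecPicard_sqErr_ne_top hU2 (by positivity) (by positivity) hgrow t
  obtain ⟨J, hJ, hJM, hJ2⟩ := exists_isItoIntegral_coord hW (c i n) hprog hfin
  obtain ⟨J', hJ', hJ'p, hJ'a, hJ'eq⟩ := hJ.exists_isStronglyProgressive
  refine ⟨J', hJ', ?_, fun t => ?_, hJ'p, fun ω => ?_⟩
  · exact hJM.congr (fun t => (hJ'p.stronglyAdapted t)) fun t => by
      filter_upwards [hJ'eq] with ω hω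
      exact (hω t).symm
  · exact (hJ2 t).ae_eq (by filter_upwards [hJ'eq] with ω hω; exact (hω t).symm)
  · exact hJ'.apply_zero ω

/-- **One Picard step exists.**  From a coordinatewise progressive, a.s. continuous, `L²(sup)` process
`U` there are square-integrable martingale Itô integrals `JV i n = ∫ σ(U)_{i n} dW^{c i n}` (progressive,
vanishing at `0`) and the process `V_i = x₀ i + ∫₀ b(U)_i ds + Σₙ JV i n` (the map `S` of the proof of
RY IX (2.1)). [folklore] -/
theorem vecPicard_step_exists [IsProbabilityMeasure P] (hW : IsBrownianVec W P) (c : ι → κ → Fin d)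
    (hK : 0 ≤ K) (hσ : ∀ x y : ι → ℝ, ∑ i, ∑ n, (σ x i n - σ y i n) ^ 2 ≤ K * ∑ i, (x i - y i) ^ 2)
    (x₀ : ι → ℝ) {U : ι → ℝ≥0 → Ω → ℝ} (hU : ∀ i, IsStronglyProgressive hW.natFiltration (U i))
    (hU2 : ∀ t : ℝ≥0, ∫⁻ ω, ⨆ s ∈ Set.Iic t, ENNReal.ofReal (∑ i, U i s ω ^ 2) ∂P < ∞) :
    ∃ (V : ι → ℝ≥0 → Ω → ℝ) (JV : ι → κ → ℝ≥0 → Ω → ℝ),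
      (∀ i n, IsItoIntegral (fun s ω => σ (fun j => U j s ω) i n) (fun s ω => W s ω (c i n)) (JV i n)
          hW.natFiltration P ∧ Martingale (JV i n) hW.natFiltration P ∧ (∀ t, MemLp (JV i n t) 2 P) ∧
          IsStronglyProgressive hW.natFiltration (JV i n) ∧ ∀ ω, JV i n 0 ω = 0) ∧
      ∀ i t ω, V i t ω = x₀ i + timeIntegral (fun s ω => b (fun j => U j s ω) i) t ω + ∑ n, JV i n t ω := by
  choose J hJ using fun i n => vecPicard_ito_exists hW c hK hσ hU hU2 i n
  exact ⟨fun i t ω => x₀ i + timeIntegral (fun s ω => b (fun j => U j s ω) i) t ω + ∑ n, J i n t ω, J, hJ,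
    fun _ _ _ => rfl⟩

end Step

end Summit.QuantumFields.YangMills.Theorems.ColdStartUniversality

end
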